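import Summits.ResolutionOfSingularities.ResolutionOfSingularities.Theses.UniformComplexity
import Summits.ResolutionOfSingularities.ResolutionOfSingularities.Theorems.UniformComplexityCampaignW82AlgClosedKernel
import Summits.ResolutionOfSingularities.ResolutionOfSingularities.Theorems.UniformComplexityPrimeModelTransferAlgClosedTower
import HarnessLib

/-!
# Slot W8.2, door 2: LINKS between the OURS residual `CampaignW82.ClimbRatFuncPerfAlgClosed` and the
# crux `UniformComplexity.PrimeModelTransfer` (stmt-ResolutionOfSingularities-8933)

Leaf file (imports the route file `Theses.UniformComplexity` directly and otherwise only Theses-free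
modules; nothing Theses-free should import it). It connects the lane-signed OURS names of
`Theorems/UniformComplexityCampaignW82AlgClosedKernel.lean` (typer res-L1-type-o6, p470934: the
shared transfer kernel, its dimension grading, and the perfection step, each with the constant field
`M` ALGEBRAICALLY CLOSED instead of merely perfect) with the prover's tower
`Theorems.PrimeModelTransfer.exists_isAlgClosed_subfield_hasResolution` and descent
`Theorems.PrimeModelTransfer.hasResolution_of_perfectSubfields` (p470438, Theses-free; assembled once
already in `Theorems.PrimeModelTransfer.primeModelTransfer_of_climbAlgClosed`, p470915, whose
hypothesis is `∀ p prime, ClimbRatFuncPerfAlgClosed p` unfolded, binder for binder — re-assembled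
here rather than imported, so that this leaf does not stack on a Theses-importing module):

* `primeModelTransfer_of_forall_climbRatFuncPerfAlgClosed` — door 2 of the W8.2 lever closes from
  the kernel at algebraically closed constant fields alone;
* `primeModelTransfer_of_forall_climbRatFuncPerfAlgClosedDimLe_top` — the same from the top grade;
* `primeModelTransfer_of_forall_climbRatFuncPerfDimLe_top` — hence from the top grade of the
  registered (perfect-`M`) graded kernel `CampaignW82.ClimbRatFuncPerfDimLe` (p466046);
* `primeModelTransfer_of_spreadOut_of_perfectionStepAlgClosed` — DOOR 2 FACTORED: the ungraded
  finite-level family transfer `SpreadOutRatFuncDimLe p ⊤ ⊤` (regular total space over `M` ⇒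
  regular generic fibre over `M(t)`; p469608, the form the transport barriers allow) plus the
  perfection step at algebraically closed `M`, `PerfectionStepAlgClosedDimLe p ⊤` (the honest
  residual: regular over `M(t)` ⇒ smooth at some finite level `M(t^{1/p^e})`), give the crux.

[OURS · LADDER-RESOLUTION L1, slot W8.2 (prime-field / universality transfer), door 2
UniformComplexity] Pure-logic links over the summit's own route; NOT statements of, and attributing
nothing to, Hironaka's 2017 manuscript.
-/

noncomputable section

set_option linter.dupNamespace false -- mandated namespace of this single-conjunct summit

open CategoryTheory CategoryTheory.Limits AlgebraicGeometry
open Literature.AlgebraicGeometry.Resolution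

namespace Summit.ResolutionOfSingularities.ResolutionOfSingularities.Theorems.CampaignW82

/-- **Door 2 closes from the kernel at algebraically closed constant fields**: if
`ClimbRatFuncPerfAlgClosed p` holds for every prime `p`, then `UniformComplexity.PrimeModelTransfer`
holds. For an algebraically closed `K` of characteristic `p`, every finite `S ⊆ K` lies in an
algebraically closed subfield with resolution
(`PrimeModelTransfer.exists_isAlgClosed_subfield_hasResolution`, the kernel used at algebraically
closed constant fields only), and resolution descends from these perfect subfields to `K`
(`PrimeModelTransfer.hasResolution_of_perfectSubfields`). Same term as
`PrimeModelTransfer.primeModelTransfer_of_climbAlgClosed` (p470915). [folklore] -/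
theorem primeModelTransfer_of_forall_climbRatFuncPerfAlgClosed
    (h : ∀ p : ℕ, p.Prime → ClimbRatFuncPerfAlgClosed p) :
    Summit.ResolutionOfSingularities.ResolutionOfSingularities.Theses.UniformComplexity.PrimeModelTransfer := by
  intro p hp hA K _ _ _ X f hs hl hq hX
  haveI : Fact p.Prime := ⟨hp⟩
  haveI : PerfectField K := IsAlgClosed.perfectField K
  refine PrimeModelTransfer.hasResolution_of_perfectSubfields K (fun s => ?_) X f hs hl hq hX
  obtain ⟨A, hsA, hAc, hAres⟩ :=
    PrimeModelTransfer.exists_isAlgClosed_subfield_hasResolution p K (fun k _ _ _ hk => hA k hk)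
      (fun M _ _ _ hM L _ _ _ _ => h p hp M hM L) s
  haveI : IsAlgClosed A := hAc
  exact ⟨A, hsA, IsAlgClosed.perfectField A, hAres⟩

/-- **The same from the top grade `(⊤, ⊤)`** of the door-2 graded kernel
(`climbRatFuncPerfAlgClosed_iff_top`). [folklore] -/
theorem primeModelTransfer_of_forall_climbRatFuncPerfAlgClosedDimLe_top
    (h : ∀ p : ℕ, p.Prime → ClimbRatFuncPerfAlgClosedDimLe p ⊤ ⊤) :
    Summit.ResolutionOfSingularities.ResolutionOfSingularities.Theses.UniformComplexity.PrimeModelTransfer :=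
  primeModelTransfer_of_forall_climbRatFuncPerfAlgClosed fun p hp =>
    (climbRatFuncPerfAlgClosed_iff_top p).2 (h p hp)

/-- **Hence from the top grade of the registered graded kernel** `ClimbRatFuncPerfDimLe p ⊤ ⊤`
(perfect constant fields; p466046), through `climbRatFuncPerfAlgClosedDimLe_of_climbRatFuncPerfDimLe`
— the algebraically closed tower refines the perfect-closure tower of p461439. [folklore] -/
theorem primeModelTransfer_of_forall_climbRatFuncPerfDimLe_top
    (h : ∀ p : ℕ, p.Prime → ClimbRatFuncPerfDimLe p ⊤ ⊤) :
    Summit.ResolutionOfSingularities.ResolutionOfSingularities.Theses.UniformComplexity.PrimeModelTransfer :=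
  primeModelTransfer_of_forall_climbRatFuncPerfAlgClosedDimLe_top fun p hp =>
    climbRatFuncPerfAlgClosedDimLe_of_climbRatFuncPerfDimLe (h p hp)

/-- **DOOR 2 FACTORED through the finite level.** The ungraded finite-level family transfer
`SpreadOutRatFuncDimLe p ⊤ ⊤` (resolution over a constant field `M` ⇒ resolution over `RatFunc M`:
spread out, resolve the regular TOTAL SPACE, restrict to the generic fibre) together with the
perfection step at ALGEBRAICALLY CLOSED `M`, `PerfectionStepAlgClosedDimLe p ⊤` (resolution over
`RatFunc M` ⇒ resolution over `M(t)^{perf}`), for every prime `p`, gives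
`UniformComplexity.PrimeModelTransfer`
(`climbRatFuncPerfAlgClosedDimLe_of_spreadOut_of_perfectionStepAlgClosed`). [folklore] -/
theorem primeModelTransfer_of_spreadOut_of_perfectionStepAlgClosed
    (h₁ : ∀ p : ℕ, p.Prime → SpreadOutRatFuncDimLe p ⊤ ⊤)
    (h₂ : ∀ p : ℕ, p.Prime → PerfectionStepAlgClosedDimLe p ⊤) :
    Summit.ResolutionOfSingularities.ResolutionOfSingularities.Theses.UniformComplexity.PrimeModelTransfer :=
  primeModelTransfer_of_forall_climbRatFuncPerfAlgClosedDimLe_top fun p hp =>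
    climbRatFuncPerfAlgClosedDimLe_of_spreadOut_of_perfectionStepAlgClosed (h₁ p hp) (h₂ p hp)

end Summit.ResolutionOfSingularities.ResolutionOfSingularities.Theorems.CampaignW82

end
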